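/-
Origin: expansion seat `prover-pub-hodgecm-mc-binder-1-g18-0`, handover #R129 2026-08-21T03:12:33Z md5 22d85f0f7b2c (445 l.; NEW additive MODEL leaf, ns HodgeCM.Model.ThetaAdelicSide; imports #R128 (this kit) + PKG #R125r2 Model/AdelicThetaDistributionMultPin (RUN 69; brings carch #CA61/#CA62) + #R127 Model/AdelicThetaDistributionMultPin34 (RUN 70; brings #CA66/#CA67) + sinst-1-g11 #1262 Model/AdelicThetaDistributionOfG (RUN 70); install AFTER #R128; drop-alone below it; 0 records, 0 `def … : Prop`, four data defs `pinDatum{Zero,One,Two,Three}G V c S hGR… χ₀ χ₁ χ₂ χ₃ hι [h₁W] hV hemb hP hχc eR eS hχ a hω hdefI : ThetaDistDatum S hV k` (= #1262 `thetaDistDatum_kOfG` at Φarch := blockFamilyOfAt … eR eS (degOnePDual Empty) (binvPi 1), harm := carch `harm_lineOmega_kG … χ_k …`, hdef := `harch_k_of_defType_tmulG … χ₀ χ₁ χ₂ χ₃ …` — carch's #CA61/#CA66 lemmas are character-generic), nothing cited; `clsU_mem_iSup_block_of_mem_holSat_pin_kG (h𝓕) (hGfin) (hLF) (Γ) (hF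 : F ∈ S.holSat hV k Γ 𝓕) : ∃ hF', S.clsU … ⟨F,hF'⟩ ∈ ⨆_{χ, charInv χ ∈ 𝓕} ⨆ ψ : ((pinDatum_kG …).coinvRep χ).asModule →ₗ Tower, range ψ` := #R128 with `hωA := rfl`, hd/hCR by #CA62/#CA67 `hd/hCR_lineOmega_kG`, Φarch ≠ 0 by PKG `blockFamilyOfAt_degOnePDual_binvPi_one_ne_zero`, hrk discharged inside #R128; two `rfl` `example`s certify `pinDatumZeroG (archSideOf …) (eta_k …) rfl … = pinDatumZero …` and `pinDatumThreeG … = pinDatumThree …` (the default-split pins #R125r2/#R127 ARE instances); NAMES for audit: HodgeCM.Model.ThetaAdelicSide.clsU_mem_iSup_block_of_mem_holSat_pinZeroG · HodgeCM.Model.ThetaAdelicSide.clsU_mem_iSup_block_of_mem_holSat_pinOneG · HodgeCM.Model.ThetaAdelicSide.clsU_mem_iSup_block_of_mem_holSat_pinThreeG; NAME LIST: HodgeCM.Model.ThetaAdelicSide.clsU_mem_iSup_block_of_mem_holSat_pinZeroG · HodgeCM.Model.ThetaAdelicSide.clsU_mem_iSup_block_of_mem_holSat_pinOneG · HodgeCM.Model.ThetaAdelicSide.clsU_mem_iSup_block_of_mem_holSat_pinThreeG;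 all decls: HodgeCM.Model.ThetaAdelicSide.pinDatumZeroG (def) · HodgeCM.Model.ThetaAdelicSide.clsU_mem_iSup_block_of_mem_holSat_pinZeroG · HodgeCM.Model.ThetaAdelicSide.pinDatumOneG (def) · HodgeCM.Model.ThetaAdelicSide.clsU_mem_iSup_block_of_mem_holSat_pinOneG · HodgeCM.Model.ThetaAdelicSide.pinDatumTwoG (def) · HodgeCM.Model.ThetaAdelicSide.clsU_mem_iSup_block_of_mem_holSat_pinTwoG · HodgeCM.Model.ThetaAdelicSide.pinDatumThreeG (def) · HodgeCM.Model.ThetaAdelicSide.clsU_mem_iSup_block_of_mem_holSat_pinThreeG) (`HOME/mc/pub-hodgecm-mc-binder-1-g18/stage71/HodgeCM/Model/AdelicThetaDistributionMultPinG.lean`, md5 22d85f0f7b2c, 445 lines);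
landed by the gen-30 packager (p-g30) in gate run 71 as `HodgeCM/Model/AdelicThetaDistributionMultPinG.lean` (verbatim).
-/
/-
Copyright (c) 2026 the pub-hodgecm formalisation cell (harness21).  New file, not vendored.
Origin: session prover-pub-hodgecm-mc-binder-1-g18-0 (unit pub-hodgecm-mc-binder-1-g18, BINDER PROVER gen 18; `hfam` clause 2 AT THE PIN for all four
slots, PIN-GENERICALLY: #R125 / #R127 re-instantiated over sinst-1-g11's pin-agnostic product Weil datum `thetaDistDatum{Zero,…,Three}OfG` (#1262)
and binder-1's pin-generic end statements (#R128 `…MultEndG`), for ANY side `S` reading `lineRepOf … χ₀ χ₁ χ₂ χ₃ k` — in particular the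
η-carrying R2 pin `SInstance.SROGT'C …` of the LEAD ROUTING WORD (R2-PIN) STATUS l.15023), 2026-08-21.
Intended final place: `HodgeCM/Model/AdelicThetaDistributionMultPinG.lean` (NEW additive model-layer leaf; imports binder-1's
`HodgeCM.Model.AdelicThetaDistributionMultEndG` (#R128), `…MultPin` (#R125, RUN 69; brings carch #CA61/#CA62) and `…MultPin34` (#R127, RUN 70; brings
#CA66/#CA67), and sinst-1's `HodgeCM.Model.AdelicThetaDistributionOfG` (#1262, RUN 70); nothing imports it; drop alone).
-/
import Summits.HodgeConjecture.HodgeCM.Model.AdelicThetaDistributionMultEndG_2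
import Summits.HodgeConjecture.HodgeCM.Model.AdelicThetaDistributionMultPin
import Summits.HodgeConjecture.HodgeCM.Model.AdelicThetaDistributionMultPin34
import Summits.HodgeConjecture.HodgeCM.Model.AdelicThetaDistributionOfG

set_option autoImplicit false

/-!
# `hfam` clause 2 at the pin, pin-generically: all four slots over any side reading `lineRepOf … χ₀ χ₁ χ₂ χ₃`

For ANY `S : ThetaAdelicSide V c` with `hι : S.ιinf = archInfOf V` and `hP : (S.P k).ω = lineRepOf V c.D hGR hGR₀ hGR₁ hGR₂ hGR₃ χ₀ χ₁ χ₂ χ₃ k`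
(arbitrary continuous split characters `χ₀ … χ₃`; `rfl, rfl` at the default-split pin `archSideOf … η …` with `χ_k := eta_k V c.D η`, AND at the
η-carrying pins `archSideOfT …` (`χ₀ := etaT₀ η ν`, `χ₁ := etaT₁ η ν`) / `archSideOfT' = archSideOfChar` under `SInstance.SROGT'C …` — the pin of
record for the row-9 discharge, lead 1-g84 STATUS l.15023):
* **`pinDatum{Zero,One,Two,Three}G … : ThetaDistDatum S hV k`** := sinst-1 #1262 `thetaDistDatum_kOfG (S) (χ₀ … χ₃) (hι) (hP) (hχc) …` at the
  standard harmonic family `blockFamilyOfAt … eR eS (degOnePDual Empty) (binvPi 1)`, with `harm := harm_lineOmega_kG … χ_k …` (carch #CA61/#CA66,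
  generic in the character; inputs `hemb`, `eR eS`, the character identity `hχ` for `χ_k` — at the η-carrying pin this is where the η-freedom is
  used —, the sign fact `h₁W` on lines 0/1) and `hdef := harch_k_of_defType_tmulG … χ₀ χ₁ χ₂ χ₃ …` (the definite exponent table `a`/`hω` and the
  definite-type identity `hdefI` for `archScalar_kG … χ_k`);
* **`clsU_mem_iSup_block_of_mem_holSat_pin{Zero,One,Two,Three}G`**: for weight functions `𝓕 ⊆ {charInv χ}`, EVERY `F ∈ S.holSat hV k Γ 𝓕` lies in
  `holSatU` and its tower class lies in `⨆_{χ, charInv χ ∈ 𝓕} ⨆_{ψ : Ω_k(χ) →ₗ Tower} range ψ`, `Ω_k(χ) = ((pinDatum_kG …).coinvRep χ).asModule` —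
  #R128 `clsU_mem_iSup_block_of_mem_holSat_of_lineRepOf_k (hP) (hωA := rfl)` with `hd`/`hCR` DISCHARGED by #CA62/#CA67 `hd/hCR_lineOmega_kG`,
  `Φarch ≠ 0` by PKG `ArchSideTerm.blockFamilyOfAt_degOnePDual_binvPi_one_ne_zero`, and the (J4-mult1) rank input DISCHARGED inside #R128 by carch
  #CA64 `rank_le_one_of_lineOmega_k`; hypotheses LEFT: the pin data, the side's `hGfin`/`hLF`, `hι`, `hP`, `h𝓕` — nothing archimedean beyond the
  pin identities, nothing cited.  At `S := archSideOf …`, `χ_k := eta_k …` these ARE #R125r2's / #R127's pin data (`pinDatumZeroG … = pinDatumZero …`, `pinDatumThreeG … = pinDatumThree …` certified by `rfl` `example`s at the end of the file; #1262 `thetaDistDatum_kOfG_archSideOf`).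
KERNEL only: four `def`s (terms of the #1246 structure via #1262), 0 records, 0 `def … : Prop`, nothing cited; `#print axioms` ⊆ {propext, Classical.choice, Quot.sound}.
-/

noncomputable section

open NumberField hiding relNormOneIdeles relNormOneRat probHaarRelNormOneQuot
open _root_.NumberField.InfinitePlace _root_.NumberField.mixedEmbedding MeasureTheory MulAction IsDedekindDomain
open scoped Matrix TensorProduct Classical SchwartzMap
open Literature.Geometry.ComplexHyperbolic.BallModel (U21 x₀ stabilizerEquivK21)
open Literature.NumberTheory.Automorphic.U21 (K21 matA sclD)
open Literature.NumberTheory.Automorphic Literature.NumberTheory.Automorphic.UnitaryGroup Literature.NumberTheory.Weil1964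
open Literature.NumberTheory.GelbartRogawski1991 Literature.NumberTheory.GelbartRogawski1991.UnitaryDualPair
open Literature.AlgebraicGeometry.HodgeTheory Literature.AlgebraicGeometry.ShimuraVarieties Literature.AlgebraicGeometry.ShimuraVarieties.BallForms
open Literature.NumberTheory.Automorphic.PicardCM
open Literature.NumberTheory.Transcendental (Arapura2012_Cor_15_4_6)
open Literature.Analysis.SegalBargmann
open HodgeCM.Adelic HodgeCM.PerL34 HodgeCM.Model.HypCensus HodgeCM.Model.ArchSideTerm HodgeCM.Model.ThetaDistFin HodgeCM.Model.TowerCarrier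
open HodgeCM.Model.SupplyInstance HodgeCM.Model.SupplyResidual HodgeCM.Model.ThetaSpace
open HodgeCM.Model.SupplyResidual.WeilPairData (charInv)

namespace HodgeCM.Model
namespace ThetaAdelicSide

variable (hHD : exists_isReal_hodgeModel) (hI : hodgePQ_independent_of_hodgeModel)
  (h₁ : BallQuotientUniformised) (h₃ : CMAbelianVarietyRealised) (hA : Arapura2012_Cor_15_4_6)
variable {L : CMField} {ι₁ : L →+* ℂ} (V : HermSpace3 L ι₁) (c : SeesawCtx L) (S : ThetaAdelicSide V c)
  (hGR : (cmSplittingDatum (L : Type) finProdFinEquiv (frameD V) (frameD_real V) (frameD_ne V) (dW c.D) (dW_real c.D)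
    (dW_ne c.D)).CompatibleSplitting)
  (hGR₀ : (cmSplittingDatum (L : Type) (e₁) (frameD V) (frameD_real V) (frameD_ne V) (lineVec (L : Type) (dW c.D 0))
    (fun _ => dW_real c.D 0) (fun _ => dW_ne c.D 0)).CompatibleSplitting)
  (hGR₁ : (cmSplittingDatum (L : Type) (e₁) (frameD V) (frameD_real V) (frameD_ne V) (lineVec (L : Type) (dW c.D 1))
    (fun _ => dW_real c.D 1) (fun _ => dW_ne c.D 1)).CompatibleSplitting)
  (hGR₂ : (cmSplittingDatum (L : Type) (e₁) (frameD V) (frameD_real V) (frameD_ne V) (lineVec (L : Type) (dW' c.D 0))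
    (fun _ => dW'_real c.D 0) (fun _ => dW'_ne c.D 0)).CompatibleSplitting)
  (hGR₃ : (cmSplittingDatum (L : Type) (e₁) (frameD V) (frameD_real V) (frameD_ne V) (lineVec (L : Type) (dW' c.D 1))
    (fun _ => dW'_real c.D 1) (fun _ => dW'_ne c.D 1)).CompatibleSplitting)
  (χ₀ χ₁ χ₂ χ₃ : CMAdelic (L : Type) (frameD V) × CMAdelicOne (L : Type) →* ℂˣ)
  (hι : S.ιinf = archInfOf V)
  (h₁W : (∀ j, 0 < (ι₁ (dW c.D j)).re) ∨ ∀ j, (ι₁ (dW c.D j)).re < 0)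
  (hV : IsAnisotropic L V.Hm)
  (hemb : (InfinitePlace.mk ι₁).embedding = ι₁)

/-! ### Slot 0 -/

section Zero

variable (hP : (S.P 0).ω = lineRepOf V c.D hGR hGR₀ hGR₁ hGR₂ hGR₃ χ₀ χ₁ χ₂ χ₃ 0)
  (hχc : Continuous fun p => ((χ₀ p : ℂˣ) : ℂ))
  (eR : PosIdx (cmXW (L : Type) (frameD V) (lineVec (L : Type) (dW c.D 0)) (fun _ => dW_real c.D 0) ι₁ (HypCensus.cmPlace (L : Type) ι₁)) ≃ Unit)
  (eS : NegIdx (cmXW (L : Type) (frameD V) (lineVec (L : Type) (dW c.D 0)) (fun _ => dW_real c.D 0) ι₁ (HypCensus.cmPlace (L : Type) ι₁)) ≃ Empty)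
  (hχ : ∀ u : stabilizer U21 x₀,
    ((lineScalar_zero V c.D hGR hGR₀ hGR₁ χ₀ (u : U21) : ℂˣ) : ℂ) *
        ((matA (stabilizerEquivK21.symm u)).det ^ (lineVacExponentsZero V c hGR₀ h₁W eR eS).eP *
          sclD (stabilizerEquivK21.symm u) ^ (lineVacExponentsZero V c hGR₀ h₁W eR eS).eQ) =
      star (sclD (stabilizerEquivK21.symm u)))
  (a : {v : InfinitePlace ↥(maximalRealSubfield L) // v.IsReal} → ℤ)
  (hω : ∀ b : {v : InfinitePlace ↥(maximalRealSubfield L) // v.IsReal}, b ≠ HypCensus.cmPlace (L : Type) ι₁ →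
    ∀ (u : UnitaryGroup.archLocal (L : Type) 3 (Matrix.diagonal (frameD V)) (cmPlaceOver (L : Type) b)) (ℓ : Module.Dual ℂ (Fin 2 → ℂ)),
      cmArchWeilRep (L : Type) e₁ (frameD V) (frameD_real V) (frameD_ne V) (lineVec (L : Type) (dW c.D 0)) (fun _ => dW_real c.D 0)
          (fun _ => dW_ne c.D 0) hGR₀
          (UnitaryGroup.archSingle (↥(maximalRealSubfield L)) L (IsCMField.complexConj L) 3 (Matrix.diagonal (frameD V))
            (IsCMField.complexConj_ne_one L) (NumberField.complexConj_smul_infinitePlace (L : Type)) (cmPlaceOver (L : Type) b) u, 1)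
          (blockFamilyOfAt (L : Type) e₁ (frameD V) (frameD_real V) (frameD_ne V) (lineVec (L : Type) (dW c.D 0)) (fun _ => dW_real c.D 0)
            (fun _ => dW_ne c.D 0) ι₁ (blockPosEquiv V) (blockNegEquiv V) eR eS (degOnePDual Empty) (binvPi 1) ℓ) =
        (((u : UnitaryGroup.archLocal (L : Type) 3 (Matrix.diagonal (frameD V)) (cmPlaceOver (L : Type) b)) : GL (Fin 3) ℂ) :
            Matrix (Fin 3) (Fin 3) ℂ).det ^ a b •
          blockFamilyOfAt (L : Type) e₁ (frameD V) (frameD_real V) (frameD_ne V) (lineVec (L : Type) (dW c.D 0)) (fun _ => dW_real c.D 0)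
            (fun _ => dW_ne c.D 0) ι₁ (blockPosEquiv V) (blockNegEquiv V) eR eS (degOnePDual Empty) (binvPi 1) ℓ)
  (hdefI : ∀ b : {v : InfinitePlace ↥(maximalRealSubfield L) // v.IsReal}, b ≠ HypCensus.cmPlace (L : Type) ι₁ →
    ∀ u : UnitaryGroup.archLocal (L : Type) 3 (Matrix.diagonal (frameD V)) (cmPlaceOver (L : Type) b),
      ((archScalar_zeroG V c.D hGR hGR₀ hGR₁ χ₀
          (UnitaryGroup.archSingle (↥(maximalRealSubfield L)) L (IsCMField.complexConj L) 3 (Matrix.diagonal (frameD V))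
            (IsCMField.complexConj_ne_one L) (NumberField.complexConj_smul_infinitePlace (L : Type)) (cmPlaceOver (L : Type) b) u) : ℂˣ) : ℂ) *
        (((u : UnitaryGroup.archLocal (L : Type) 3 (Matrix.diagonal (frameD V)) (cmPlaceOver (L : Type) b)) : GL (Fin 3) ℂ) :
            Matrix (Fin 3) (Fin 3) ℂ).det ^ a b = 1)

/-- **The slot-0 product Weil datum AT THE PIN, pin-generically**: sinst-1 #1262 `thetaDistDatumZeroOfG …` at the standard harmonic family
`blockFamilyOfAt … eR eS (degOnePDual Empty) (binvPi 1)`, with `harm`/`hdef` supplied by carch's character-generic `harm_lineOmega_zeroG` /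
`harch_zero_of_defType_tmulG` at `χ₀` / `χ₀ χ₁ χ₂ χ₃`. -/
def pinDatumZeroG : ThetaDistDatum S hV 0 :=
  thetaDistDatumZeroOfG V c S hGR hGR₀ hGR₁ hGR₂ hGR₃ χ₀ χ₁ χ₂ χ₃ hι h₁W hV hP hχc
    (blockFamilyOfAt (L : Type) e₁ (frameD V) (frameD_real V) (frameD_ne V) (lineVec (L : Type) (dW c.D 0)) (fun _ => dW_real c.D 0)
            (fun _ => dW_ne c.D 0) ι₁ (blockPosEquiv V) (blockNegEquiv V) eR eS (degOnePDual Empty) (binvPi 1))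
    (harm_lineOmega_zeroG V c hGR hGR₀ hGR₁ χ₀ h₁W (binvPi 1) hemb eR eS hχ)
    (harch_zero_of_defType_tmulG V c.D hGR hGR₀ hGR₁ hGR₂ hGR₃ χ₀ χ₁ χ₂ χ₃ hV eR eS a hω hdefI)

/-- **`hfam` clause 2 at the pin, slot 0, pin-generically — NO archimedean hypothesis beyond the pin identities**: for weight functions
`𝓕 ⊆ {charInv χ}`, EVERY `F ∈ S.holSat hV 0 Γ 𝓕` lies in `holSatU` and has its tower class in `⨆_{χ, charInv χ ∈ 𝓕} block(Ω_0(χ))`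
((J4-mult1) discharged inside #R128 by carch #CA64). -/
theorem clsU_mem_iSup_block_of_mem_holSat_pinZeroG
    {𝓕 : Set C(↥(relNormOneIdeles (↥(maximalRealSubfield L)) L) ⧸ relNormOneRat (↥(maximalRealSubfield L)) L, ℂ)}
    (h𝓕 : ∀ f ∈ 𝓕, ∃ χ : PontryaginDual (↥(relNormOneIdeles (↥(maximalRealSubfield L)) L) ⧸ relNormOneRat (↥(maximalRealSubfield L)) L),
      f = charInv χ)
    (hGfin : ∀ K : Subgroup ↥V.adelicFin, ThetaDistDatum.satG hV K ≤ S.Gfin) (hLF : (S.P 0).IsLFAction) (Γ : Level V)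
    {F : (V.latticeModel printFact_unitaryCompact_holds).G → (Fin 2 → ℂ)} (hF : F ∈ S.holSat hV 0 Γ 𝓕) :
    ∃ hF' : F ∈ S.holSatU hV 0 𝓕,
      S.clsU hHD hI h₁ h₃ hA 𝓕 hι hV 0 ⟨F, hF'⟩ ∈
        ⨆ (χ : PontryaginDual (↥(relNormOneIdeles (↥(maximalRealSubfield L)) L) ⧸ relNormOneRat (↥(maximalRealSubfield L)) L))
          (_ : charInv χ ∈ 𝓕),
          ⨆ ψ : ((pinDatumZeroG V c S hGR hGR₀ hGR₁ hGR₂ hGR₃ χ₀ χ₁ χ₂ χ₃ hι h₁W hV hemb hP hχc eR eS hχ a hω hdefI).coinvRep χ).asModule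
              →ₗ[MonoidAlgebra ℂ ↥V.adelicFin] Tower hHD hI (ballQuotientUniformisedDatum_of h₁) h₃ hA V,
            (LinearMap.range ψ).restrictScalars ℂ :=
  (pinDatumZeroG V c S hGR hGR₀ hGR₁ hGR₂ hGR₃ χ₀ χ₁ χ₂ χ₃ hι h₁W hV hemb hP hχc eR eS hχ a hω hdefI).clsU_mem_iSup_block_of_mem_holSat_of_lineRepOf_zero
    hHD hI h₁ h₃ hA hGR hGR₀ hGR₁ hGR₂ hGR₃ χ₀ χ₁ χ₂ χ₃ h𝓕 hP rfl
    (fun h => ArchSideTerm.blockFamilyOfAt_degOnePDual_binvPi_one_ne_zero Empty (L : Type) e₁ (frameD V) (frameD_real V) (frameD_ne V)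
      (lineVec (L : Type) (dW c.D 0)) (fun _ => dW_real c.D 0) (fun _ => dW_ne c.D 0) ι₁ (blockPosEquiv V) (blockNegEquiv V) eR eS
      (by change (pinDatumZeroG V c S hGR hGR₀ hGR₁ hGR₂ hGR₃ χ₀ χ₁ χ₂ χ₃ hι h₁W hV hemb hP hχc eR eS hχ a hω hdefI).Φarch _ = 0; rw [h]; rfl))
    hGfin hLF
    (hd_lineOmega_zeroG V c hGR hGR₀ hGR₁ χ₀ h₁W (binvPi 1) eR eS hemb)
    (hCR_lineOmega_zeroG V c hGR hGR₀ hGR₁ χ₀ h₁W (binvPi 1) eR eS hemb) hι Γ hF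

end Zero

/-! ### Slot 1 -/

section One

variable (hP : (S.P 1).ω = lineRepOf V c.D hGR hGR₀ hGR₁ hGR₂ hGR₃ χ₀ χ₁ χ₂ χ₃ 1)
  (hχc : Continuous fun p => ((χ₁ p : ℂˣ) : ℂ))
  (eR : PosIdx (cmXW (L : Type) (frameD V) (lineVec (L : Type) (dW c.D 1)) (fun _ => dW_real c.D 1) ι₁ (HypCensus.cmPlace (L : Type) ι₁)) ≃ Unit)
  (eS : NegIdx (cmXW (L : Type) (frameD V) (lineVec (L : Type) (dW c.D 1)) (fun _ => dW_real c.D 1) ι₁ (HypCensus.cmPlace (L : Type) ι₁)) ≃ Empty)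
  (hχ : ∀ u : stabilizer U21 x₀,
    ((lineScalar_one V c.D hGR hGR₀ hGR₁ χ₁ (u : U21) : ℂˣ) : ℂ) *
        ((matA (stabilizerEquivK21.symm u)).det ^ (lineVacExponentsOne V c hGR₁ h₁W eR eS).eP *
          sclD (stabilizerEquivK21.symm u) ^ (lineVacExponentsOne V c hGR₁ h₁W eR eS).eQ) =
      star (sclD (stabilizerEquivK21.symm u)))
  (a : {v : InfinitePlace ↥(maximalRealSubfield L) // v.IsReal} → ℤ)
  (hω : ∀ b : {v : InfinitePlace ↥(maximalRealSubfield L) // v.IsReal}, b ≠ HypCensus.cmPlace (L : Type) ι₁ →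
    ∀ (u : UnitaryGroup.archLocal (L : Type) 3 (Matrix.diagonal (frameD V)) (cmPlaceOver (L : Type) b)) (ℓ : Module.Dual ℂ (Fin 2 → ℂ)),
      cmArchWeilRep (L : Type) e₁ (frameD V) (frameD_real V) (frameD_ne V) (lineVec (L : Type) (dW c.D 1)) (fun _ => dW_real c.D 1)
          (fun _ => dW_ne c.D 1) hGR₁
          (UnitaryGroup.archSingle (↥(maximalRealSubfield L)) L (IsCMField.complexConj L) 3 (Matrix.diagonal (frameD V))
            (IsCMField.complexConj_ne_one L) (NumberField.complexConj_smul_infinitePlace (L : Type)) (cmPlaceOver (L : Type) b) u, 1)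
          (blockFamilyOfAt (L : Type) e₁ (frameD V) (frameD_real V) (frameD_ne V) (lineVec (L : Type) (dW c.D 1)) (fun _ => dW_real c.D 1)
            (fun _ => dW_ne c.D 1) ι₁ (blockPosEquiv V) (blockNegEquiv V) eR eS (degOnePDual Empty) (binvPi 1) ℓ) =
        (((u : UnitaryGroup.archLocal (L : Type) 3 (Matrix.diagonal (frameD V)) (cmPlaceOver (L : Type) b)) : GL (Fin 3) ℂ) :
            Matrix (Fin 3) (Fin 3) ℂ).det ^ a b •
          blockFamilyOfAt (L : Type) e₁ (frameD V) (frameD_real V) (frameD_ne V) (lineVec (L : Type) (dW c.D 1)) (fun _ => dW_real c.D 1)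
            (fun _ => dW_ne c.D 1) ι₁ (blockPosEquiv V) (blockNegEquiv V) eR eS (degOnePDual Empty) (binvPi 1) ℓ)
  (hdefI : ∀ b : {v : InfinitePlace ↥(maximalRealSubfield L) // v.IsReal}, b ≠ HypCensus.cmPlace (L : Type) ι₁ →
    ∀ u : UnitaryGroup.archLocal (L : Type) 3 (Matrix.diagonal (frameD V)) (cmPlaceOver (L : Type) b),
      ((archScalar_oneG V c.D hGR hGR₀ hGR₁ χ₁
          (UnitaryGroup.archSingle (↥(maximalRealSubfield L)) L (IsCMField.complexConj L) 3 (Matrix.diagonal (frameD V))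
            (IsCMField.complexConj_ne_one L) (NumberField.complexConj_smul_infinitePlace (L : Type)) (cmPlaceOver (L : Type) b) u) : ℂˣ) : ℂ) *
        (((u : UnitaryGroup.archLocal (L : Type) 3 (Matrix.diagonal (frameD V)) (cmPlaceOver (L : Type) b)) : GL (Fin 3) ℂ) :
            Matrix (Fin 3) (Fin 3) ℂ).det ^ a b = 1)

/-- **The slot-1 product Weil datum AT THE PIN, pin-generically**: sinst-1 #1262 `thetaDistDatumOneOfG …` at the standard harmonic family
`blockFamilyOfAt … eR eS (degOnePDual Empty) (binvPi 1)`, with `harm`/`hdef` supplied by carch's character-generic `harm_lineOmega_oneG` /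
`harch_one_of_defType_tmulG` at `χ₁` / `χ₀ χ₁ χ₂ χ₃`. -/
def pinDatumOneG : ThetaDistDatum S hV 1 :=
  thetaDistDatumOneOfG V c S hGR hGR₀ hGR₁ hGR₂ hGR₃ χ₀ χ₁ χ₂ χ₃ hι hV hP hχc
    (blockFamilyOfAt (L : Type) e₁ (frameD V) (frameD_real V) (frameD_ne V) (lineVec (L : Type) (dW c.D 1)) (fun _ => dW_real c.D 1)
            (fun _ => dW_ne c.D 1) ι₁ (blockPosEquiv V) (blockNegEquiv V) eR eS (degOnePDual Empty) (binvPi 1))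
    (harm_lineOmega_oneG V c hGR hGR₀ hGR₁ χ₁ h₁W (binvPi 1) hemb eR eS hχ)
    (harch_one_of_defType_tmulG V c.D hGR hGR₀ hGR₁ hGR₂ hGR₃ χ₀ χ₁ χ₂ χ₃ hV eR eS a hω hdefI)

/-- **`hfam` clause 2 at the pin, slot 1, pin-generically — NO archimedean hypothesis beyond the pin identities**: for weight functions
`𝓕 ⊆ {charInv χ}`, EVERY `F ∈ S.holSat hV 1 Γ 𝓕` lies in `holSatU` and has its tower class in `⨆_{χ, charInv χ ∈ 𝓕} block(Ω_1(χ))`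
((J4-mult1) discharged inside #R128 by carch #CA64). -/
theorem clsU_mem_iSup_block_of_mem_holSat_pinOneG
    {𝓕 : Set C(↥(relNormOneIdeles (↥(maximalRealSubfield L)) L) ⧸ relNormOneRat (↥(maximalRealSubfield L)) L, ℂ)}
    (h𝓕 : ∀ f ∈ 𝓕, ∃ χ : PontryaginDual (↥(relNormOneIdeles (↥(maximalRealSubfield L)) L) ⧸ relNormOneRat (↥(maximalRealSubfield L)) L),
      f = charInv χ)
    (hGfin : ∀ K : Subgroup ↥V.adelicFin, ThetaDistDatum.satG hV K ≤ S.Gfin) (hLF : (S.P 1).IsLFAction) (Γ : Level V)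
    {F : (V.latticeModel printFact_unitaryCompact_holds).G → (Fin 2 → ℂ)} (hF : F ∈ S.holSat hV 1 Γ 𝓕) :
    ∃ hF' : F ∈ S.holSatU hV 1 𝓕,
      S.clsU hHD hI h₁ h₃ hA 𝓕 hι hV 1 ⟨F, hF'⟩ ∈
        ⨆ (χ : PontryaginDual (↥(relNormOneIdeles (↥(maximalRealSubfield L)) L) ⧸ relNormOneRat (↥(maximalRealSubfield L)) L))
          (_ : charInv χ ∈ 𝓕),
          ⨆ ψ : ((pinDatumOneG V c S hGR hGR₀ hGR₁ hGR₂ hGR₃ χ₀ χ₁ χ₂ χ₃ hι h₁W hV hemb hP hχc eR eS hχ a hω hdefI).coinvRep χ).asModule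
              →ₗ[MonoidAlgebra ℂ ↥V.adelicFin] Tower hHD hI (ballQuotientUniformisedDatum_of h₁) h₃ hA V,
            (LinearMap.range ψ).restrictScalars ℂ :=
  (pinDatumOneG V c S hGR hGR₀ hGR₁ hGR₂ hGR₃ χ₀ χ₁ χ₂ χ₃ hι h₁W hV hemb hP hχc eR eS hχ a hω hdefI).clsU_mem_iSup_block_of_mem_holSat_of_lineRepOf_one
    hHD hI h₁ h₃ hA hGR hGR₀ hGR₁ hGR₂ hGR₃ χ₀ χ₁ χ₂ χ₃ h𝓕 hP rfl
    (fun h => ArchSideTerm.blockFamilyOfAt_degOnePDual_binvPi_one_ne_zero Empty (L : Type) e₁ (frameD V) (frameD_real V) (frameD_ne V)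
      (lineVec (L : Type) (dW c.D 1)) (fun _ => dW_real c.D 1) (fun _ => dW_ne c.D 1) ι₁ (blockPosEquiv V) (blockNegEquiv V) eR eS
      (by change (pinDatumOneG V c S hGR hGR₀ hGR₁ hGR₂ hGR₃ χ₀ χ₁ χ₂ χ₃ hι h₁W hV hemb hP hχc eR eS hχ a hω hdefI).Φarch _ = 0; rw [h]; rfl))
    hGfin hLF
    (hd_lineOmega_oneG V c hGR hGR₀ hGR₁ χ₁ h₁W (binvPi 1) eR eS hemb)
    (hCR_lineOmega_oneG V c hGR hGR₀ hGR₁ χ₁ h₁W (binvPi 1) eR eS hemb) hι Γ hF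

end One

/-! ### Slot 2 -/

section Two

variable (hP : (S.P 2).ω = lineRepOf V c.D hGR hGR₀ hGR₁ hGR₂ hGR₃ χ₀ χ₁ χ₂ χ₃ 2)
  (hχc : Continuous fun p => ((χ₂ p : ℂˣ) : ℂ))
  (eR : PosIdx (cmXW (L : Type) (frameD V) (lineVec (L : Type) (dW' c.D 0)) (fun _ => dW'_real c.D 0) ι₁ (HypCensus.cmPlace (L : Type) ι₁)) ≃ Unit)
  (eS : NegIdx (cmXW (L : Type) (frameD V) (lineVec (L : Type) (dW' c.D 0)) (fun _ => dW'_real c.D 0) ι₁ (HypCensus.cmPlace (L : Type) ι₁)) ≃ Empty)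
  (hχ : ∀ u : stabilizer U21 x₀,
    ((lineScalar_two V c.D hGR hGR₂ hGR₃ χ₂ (u : U21) : ℂˣ) : ℂ) *
        ((matA (stabilizerEquivK21.symm u)).det ^ (lineVacExponentsTwo V c hGR₂ eR eS).eP *
          sclD (stabilizerEquivK21.symm u) ^ (lineVacExponentsTwo V c hGR₂ eR eS).eQ) =
      star (sclD (stabilizerEquivK21.symm u)))
  (a : {v : InfinitePlace ↥(maximalRealSubfield L) // v.IsReal} → ℤ)
  (hω : ∀ b : {v : InfinitePlace ↥(maximalRealSubfield L) // v.IsReal}, b ≠ HypCensus.cmPlace (L : Type) ι₁ →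
    ∀ (u : UnitaryGroup.archLocal (L : Type) 3 (Matrix.diagonal (frameD V)) (cmPlaceOver (L : Type) b)) (ℓ : Module.Dual ℂ (Fin 2 → ℂ)),
      cmArchWeilRep (L : Type) e₁ (frameD V) (frameD_real V) (frameD_ne V) (lineVec (L : Type) (dW' c.D 0)) (fun _ => dW'_real c.D 0)
          (fun _ => dW'_ne c.D 0) hGR₂
          (UnitaryGroup.archSingle (↥(maximalRealSubfield L)) L (IsCMField.complexConj L) 3 (Matrix.diagonal (frameD V))
            (IsCMField.complexConj_ne_one L) (NumberField.complexConj_smul_infinitePlace (L : Type)) (cmPlaceOver (L : Type) b) u, 1)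
          (blockFamilyOfAt (L : Type) e₁ (frameD V) (frameD_real V) (frameD_ne V) (lineVec (L : Type) (dW' c.D 0)) (fun _ => dW'_real c.D 0)
            (fun _ => dW'_ne c.D 0) ι₁ (blockPosEquiv V) (blockNegEquiv V) eR eS (degOnePDual Empty) (binvPi 1) ℓ) =
        (((u : UnitaryGroup.archLocal (L : Type) 3 (Matrix.diagonal (frameD V)) (cmPlaceOver (L : Type) b)) : GL (Fin 3) ℂ) :
            Matrix (Fin 3) (Fin 3) ℂ).det ^ a b •
          blockFamilyOfAt (L : Type) e₁ (frameD V) (frameD_real V) (frameD_ne V) (lineVec (L : Type) (dW' c.D 0)) (fun _ => dW'_real c.D 0)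
            (fun _ => dW'_ne c.D 0) ι₁ (blockPosEquiv V) (blockNegEquiv V) eR eS (degOnePDual Empty) (binvPi 1) ℓ)
  (hdefI : ∀ b : {v : InfinitePlace ↥(maximalRealSubfield L) // v.IsReal}, b ≠ HypCensus.cmPlace (L : Type) ι₁ →
    ∀ u : UnitaryGroup.archLocal (L : Type) 3 (Matrix.diagonal (frameD V)) (cmPlaceOver (L : Type) b),
      ((archScalar_twoG V c.D hGR hGR₂ hGR₃ χ₂
          (UnitaryGroup.archSingle (↥(maximalRealSubfield L)) L (IsCMField.complexConj L) 3 (Matrix.diagonal (frameD V))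
            (IsCMField.complexConj_ne_one L) (NumberField.complexConj_smul_infinitePlace (L : Type)) (cmPlaceOver (L : Type) b) u) : ℂˣ) : ℂ) *
        (((u : UnitaryGroup.archLocal (L : Type) 3 (Matrix.diagonal (frameD V)) (cmPlaceOver (L : Type) b)) : GL (Fin 3) ℂ) :
            Matrix (Fin 3) (Fin 3) ℂ).det ^ a b = 1)

/-- **The slot-2 product Weil datum AT THE PIN, pin-generically**: sinst-1 #1262 `thetaDistDatumTwoOfG …` at the standard harmonic family
`blockFamilyOfAt … eR eS (degOnePDual Empty) (binvPi 1)`, with `harm`/`hdef` supplied by carch's character-generic `harm_lineOmega_twoG` /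
`harch_two_of_defType_tmulG` at `χ₂` / `χ₀ χ₁ χ₂ χ₃`. -/
def pinDatumTwoG : ThetaDistDatum S hV 2 :=
  thetaDistDatumTwoOfG V c S hGR hGR₀ hGR₁ hGR₂ hGR₃ χ₀ χ₁ χ₂ χ₃ hι h₁W hV hP hχc
    (blockFamilyOfAt (L : Type) e₁ (frameD V) (frameD_real V) (frameD_ne V) (lineVec (L : Type) (dW' c.D 0)) (fun _ => dW'_real c.D 0)
            (fun _ => dW'_ne c.D 0) ι₁ (blockPosEquiv V) (blockNegEquiv V) eR eS (degOnePDual Empty) (binvPi 1))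
    (harm_lineOmega_twoG V c hGR hGR₂ hGR₃ χ₂ (binvPi 1) hemb eR eS hχ)
    (harch_two_of_defType_tmulG V c.D hGR hGR₀ hGR₁ hGR₂ hGR₃ χ₀ χ₁ χ₂ χ₃ hV eR eS a hω hdefI)

/-- **`hfam` clause 2 at the pin, slot 2, pin-generically — NO archimedean hypothesis beyond the pin identities**: for weight functions
`𝓕 ⊆ {charInv χ}`, EVERY `F ∈ S.holSat hV 2 Γ 𝓕` lies in `holSatU` and has its tower class in `⨆_{χ, charInv χ ∈ 𝓕} block(Ω_2(χ))`
((J4-mult1) discharged inside #R128 by carch #CA64). -/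
theorem clsU_mem_iSup_block_of_mem_holSat_pinTwoG
    {𝓕 : Set C(↥(relNormOneIdeles (↥(maximalRealSubfield L)) L) ⧸ relNormOneRat (↥(maximalRealSubfield L)) L, ℂ)}
    (h𝓕 : ∀ f ∈ 𝓕, ∃ χ : PontryaginDual (↥(relNormOneIdeles (↥(maximalRealSubfield L)) L) ⧸ relNormOneRat (↥(maximalRealSubfield L)) L),
      f = charInv χ)
    (hGfin : ∀ K : Subgroup ↥V.adelicFin, ThetaDistDatum.satG hV K ≤ S.Gfin) (hLF : (S.P 2).IsLFAction) (Γ : Level V)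
    {F : (V.latticeModel printFact_unitaryCompact_holds).G → (Fin 2 → ℂ)} (hF : F ∈ S.holSat hV 2 Γ 𝓕) :
    ∃ hF' : F ∈ S.holSatU hV 2 𝓕,
      S.clsU hHD hI h₁ h₃ hA 𝓕 hι hV 2 ⟨F, hF'⟩ ∈
        ⨆ (χ : PontryaginDual (↥(relNormOneIdeles (↥(maximalRealSubfield L)) L) ⧸ relNormOneRat (↥(maximalRealSubfield L)) L))
          (_ : charInv χ ∈ 𝓕),
          ⨆ ψ : ((pinDatumTwoG V c S hGR hGR₀ hGR₁ hGR₂ hGR₃ χ₀ χ₁ χ₂ χ₃ hι h₁W hV hemb hP hχc eR eS hχ a hω hdefI).coinvRep χ).asModule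
              →ₗ[MonoidAlgebra ℂ ↥V.adelicFin] Tower hHD hI (ballQuotientUniformisedDatum_of h₁) h₃ hA V,
            (LinearMap.range ψ).restrictScalars ℂ :=
  (pinDatumTwoG V c S hGR hGR₀ hGR₁ hGR₂ hGR₃ χ₀ χ₁ χ₂ χ₃ hι h₁W hV hemb hP hχc eR eS hχ a hω hdefI).clsU_mem_iSup_block_of_mem_holSat_of_lineRepOf_two
    hHD hI h₁ h₃ hA hGR hGR₀ hGR₁ hGR₂ hGR₃ χ₀ χ₁ χ₂ χ₃ h𝓕 hP rfl
    (fun h => ArchSideTerm.blockFamilyOfAt_degOnePDual_binvPi_one_ne_zero Empty (L : Type) e₁ (frameD V) (frameD_real V) (frameD_ne V)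
      (lineVec (L : Type) (dW' c.D 0)) (fun _ => dW'_real c.D 0) (fun _ => dW'_ne c.D 0) ι₁ (blockPosEquiv V) (blockNegEquiv V) eR eS
      (by change (pinDatumTwoG V c S hGR hGR₀ hGR₁ hGR₂ hGR₃ χ₀ χ₁ χ₂ χ₃ hι h₁W hV hemb hP hχc eR eS hχ a hω hdefI).Φarch _ = 0; rw [h]; rfl))
    hGfin hLF
    (hd_lineOmega_twoG V c hGR hGR₂ hGR₃ χ₂ (binvPi 1) eR eS hemb)
    (hCR_lineOmega_twoG V c hGR hGR₂ hGR₃ χ₂ (binvPi 1) eR eS hemb) hι Γ hF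

end Two

/-! ### Slot 3 -/

section Three

variable (hP : (S.P 3).ω = lineRepOf V c.D hGR hGR₀ hGR₁ hGR₂ hGR₃ χ₀ χ₁ χ₂ χ₃ 3)
  (hχc : Continuous fun p => ((χ₃ p : ℂˣ) : ℂ))
  (eR : PosIdx (cmXW (L : Type) (frameD V) (lineVec (L : Type) (dW' c.D 1)) (fun _ => dW'_real c.D 1) ι₁ (HypCensus.cmPlace (L : Type) ι₁)) ≃ Unit)
  (eS : NegIdx (cmXW (L : Type) (frameD V) (lineVec (L : Type) (dW' c.D 1)) (fun _ => dW'_real c.D 1) ι₁ (HypCensus.cmPlace (L : Type) ι₁)) ≃ Empty)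
  (hχ : ∀ u : stabilizer U21 x₀,
    ((lineScalar_three V c.D hGR hGR₂ hGR₃ χ₃ (u : U21) : ℂˣ) : ℂ) *
        ((matA (stabilizerEquivK21.symm u)).det ^ (lineVacExponentsThree V c hGR₃ eR eS).eP *
          sclD (stabilizerEquivK21.symm u) ^ (lineVacExponentsThree V c hGR₃ eR eS).eQ) =
      star (sclD (stabilizerEquivK21.symm u)))
  (a : {v : InfinitePlace ↥(maximalRealSubfield L) // v.IsReal} → ℤ)
  (hω : ∀ b : {v : InfinitePlace ↥(maximalRealSubfield L) // v.IsReal}, b ≠ HypCensus.cmPlace (L : Type) ι₁ →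
    ∀ (u : UnitaryGroup.archLocal (L : Type) 3 (Matrix.diagonal (frameD V)) (cmPlaceOver (L : Type) b)) (ℓ : Module.Dual ℂ (Fin 2 → ℂ)),
      cmArchWeilRep (L : Type) e₁ (frameD V) (frameD_real V) (frameD_ne V) (lineVec (L : Type) (dW' c.D 1)) (fun _ => dW'_real c.D 1)
          (fun _ => dW'_ne c.D 1) hGR₃
          (UnitaryGroup.archSingle (↥(maximalRealSubfield L)) L (IsCMField.complexConj L) 3 (Matrix.diagonal (frameD V))
            (IsCMField.complexConj_ne_one L) (NumberField.complexConj_smul_infinitePlace (L : Type)) (cmPlaceOver (L : Type) b) u, 1)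
          (blockFamilyOfAt (L : Type) e₁ (frameD V) (frameD_real V) (frameD_ne V) (lineVec (L : Type) (dW' c.D 1)) (fun _ => dW'_real c.D 1)
            (fun _ => dW'_ne c.D 1) ι₁ (blockPosEquiv V) (blockNegEquiv V) eR eS (degOnePDual Empty) (binvPi 1) ℓ) =
        (((u : UnitaryGroup.archLocal (L : Type) 3 (Matrix.diagonal (frameD V)) (cmPlaceOver (L : Type) b)) : GL (Fin 3) ℂ) :
            Matrix (Fin 3) (Fin 3) ℂ).det ^ a b •
          blockFamilyOfAt (L : Type) e₁ (frameD V) (frameD_real V) (frameD_ne V) (lineVec (L : Type) (dW' c.D 1)) (fun _ => dW'_real c.D 1)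
            (fun _ => dW'_ne c.D 1) ι₁ (blockPosEquiv V) (blockNegEquiv V) eR eS (degOnePDual Empty) (binvPi 1) ℓ)
  (hdefI : ∀ b : {v : InfinitePlace ↥(maximalRealSubfield L) // v.IsReal}, b ≠ HypCensus.cmPlace (L : Type) ι₁ →
    ∀ u : UnitaryGroup.archLocal (L : Type) 3 (Matrix.diagonal (frameD V)) (cmPlaceOver (L : Type) b),
      ((archScalar_threeG V c.D hGR hGR₂ hGR₃ χ₃
          (UnitaryGroup.archSingle (↥(maximalRealSubfield L)) L (IsCMField.complexConj L) 3 (Matrix.diagonal (frameD V))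
            (IsCMField.complexConj_ne_one L) (NumberField.complexConj_smul_infinitePlace (L : Type)) (cmPlaceOver (L : Type) b) u) : ℂˣ) : ℂ) *
        (((u : UnitaryGroup.archLocal (L : Type) 3 (Matrix.diagonal (frameD V)) (cmPlaceOver (L : Type) b)) : GL (Fin 3) ℂ) :
            Matrix (Fin 3) (Fin 3) ℂ).det ^ a b = 1)

/-- **The slot-3 product Weil datum AT THE PIN, pin-generically**: sinst-1 #1262 `thetaDistDatumThreeOfG …` at the standard harmonic family
`blockFamilyOfAt … eR eS (degOnePDual Empty) (binvPi 1)`, with `harm`/`hdef` supplied by carch's character-generic `harm_lineOmega_threeG` /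
`harch_three_of_defType_tmulG` at `χ₃` / `χ₀ χ₁ χ₂ χ₃`. -/
def pinDatumThreeG : ThetaDistDatum S hV 3 :=
  thetaDistDatumThreeOfG V c S hGR hGR₀ hGR₁ hGR₂ hGR₃ χ₀ χ₁ χ₂ χ₃ hι hV hP hχc
    (blockFamilyOfAt (L : Type) e₁ (frameD V) (frameD_real V) (frameD_ne V) (lineVec (L : Type) (dW' c.D 1)) (fun _ => dW'_real c.D 1)
            (fun _ => dW'_ne c.D 1) ι₁ (blockPosEquiv V) (blockNegEquiv V) eR eS (degOnePDual Empty) (binvPi 1))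
    (harm_lineOmega_threeG V c hGR hGR₂ hGR₃ χ₃ (binvPi 1) hemb eR eS hχ)
    (harch_three_of_defType_tmulG V c.D hGR hGR₀ hGR₁ hGR₂ hGR₃ χ₀ χ₁ χ₂ χ₃ hV eR eS a hω hdefI)

/-- **`hfam` clause 2 at the pin, slot 3, pin-generically — NO archimedean hypothesis beyond the pin identities**: for weight functions
`𝓕 ⊆ {charInv χ}`, EVERY `F ∈ S.holSat hV 3 Γ 𝓕` lies in `holSatU` and has its tower class in `⨆_{χ, charInv χ ∈ 𝓕} block(Ω_3(χ))`
((J4-mult1) discharged inside #R128 by carch #CA64). -/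
theorem clsU_mem_iSup_block_of_mem_holSat_pinThreeG
    {𝓕 : Set C(↥(relNormOneIdeles (↥(maximalRealSubfield L)) L) ⧸ relNormOneRat (↥(maximalRealSubfield L)) L, ℂ)}
    (h𝓕 : ∀ f ∈ 𝓕, ∃ χ : PontryaginDual (↥(relNormOneIdeles (↥(maximalRealSubfield L)) L) ⧸ relNormOneRat (↥(maximalRealSubfield L)) L),
      f = charInv χ)
    (hGfin : ∀ K : Subgroup ↥V.adelicFin, ThetaDistDatum.satG hV K ≤ S.Gfin) (hLF : (S.P 3).IsLFAction) (Γ : Level V)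
    {F : (V.latticeModel printFact_unitaryCompact_holds).G → (Fin 2 → ℂ)} (hF : F ∈ S.holSat hV 3 Γ 𝓕) :
    ∃ hF' : F ∈ S.holSatU hV 3 𝓕,
      S.clsU hHD hI h₁ h₃ hA 𝓕 hι hV 3 ⟨F, hF'⟩ ∈
        ⨆ (χ : PontryaginDual (↥(relNormOneIdeles (↥(maximalRealSubfield L)) L) ⧸ relNormOneRat (↥(maximalRealSubfield L)) L))
          (_ : charInv χ ∈ 𝓕),
          ⨆ ψ : ((pinDatumThreeG V c S hGR hGR₀ hGR₁ hGR₂ hGR₃ χ₀ χ₁ χ₂ χ₃ hι hV hemb hP hχc eR eS hχ a hω hdefI).coinvRep χ).asModule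
              →ₗ[MonoidAlgebra ℂ ↥V.adelicFin] Tower hHD hI (ballQuotientUniformisedDatum_of h₁) h₃ hA V,
            (LinearMap.range ψ).restrictScalars ℂ :=
  (pinDatumThreeG V c S hGR hGR₀ hGR₁ hGR₂ hGR₃ χ₀ χ₁ χ₂ χ₃ hι hV hemb hP hχc eR eS hχ a hω hdefI).clsU_mem_iSup_block_of_mem_holSat_of_lineRepOf_three
    hHD hI h₁ h₃ hA hGR hGR₀ hGR₁ hGR₂ hGR₃ χ₀ χ₁ χ₂ χ₃ h𝓕 hP rfl
    (fun h => ArchSideTerm.blockFamilyOfAt_degOnePDual_binvPi_one_ne_zero Empty (L : Type) e₁ (frameD V) (frameD_real V) (frameD_ne V)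
      (lineVec (L : Type) (dW' c.D 1)) (fun _ => dW'_real c.D 1) (fun _ => dW'_ne c.D 1) ι₁ (blockPosEquiv V) (blockNegEquiv V) eR eS
      (by change (pinDatumThreeG V c S hGR hGR₀ hGR₁ hGR₂ hGR₃ χ₀ χ₁ χ₂ χ₃ hι hV hemb hP hχc eR eS hχ a hω hdefI).Φarch _ = 0; rw [h]; rfl))
    hGfin hLF
    (hd_lineOmega_threeG V c hGR hGR₂ hGR₃ χ₃ (binvPi 1) eR eS hemb)
    (hCR_lineOmega_threeG V c hGR hGR₂ hGR₃ χ₃ (binvPi 1) eR eS hemb) hι Γ hF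

end Three

/-! ### At the default-split pin these are #R125r2's / #R127's pin data (`rfl` certification, no new declaration) -/

section DefaultSplit

variable
  (η : CMAdelic (L : Type) (frameD V) × CMAdelic (L : Type) (dW c.D) →* ℂˣ)
  (hη : ∀ γU ∈ CMRat (L : Type) (frameD V), ∀ γ ∈ CMRat (L : Type) (dW c.D), η (γU, γ) = 1)
  (hηc : Continuous fun p => ((η p : ℂˣ) : ℂ))
  (A : ∀ k : Fin 4, ArchLineInput V (lineRepD V c.D hGR hGR₀ hGR₁ hGR₂ hGR₃ η k))


-- port_pkg: scope closed for this part
end DefaultSplit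
end ThetaAdelicSide
end HodgeCM.Model
end
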